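import Literature.Barriers.PneNP.MonotoneGapPerfectMatchingProofs
import HarnessLib

/-!
# Cavalar–Göös–Riazanov–Sofronova–Sokolov: bipartite perfect matching needs monotone circuits
# of size `2^{n^{1/3-o(1)}}`; the Matching Sunflower Lemma

Named facts (D-0014; ledger item `wi-68630`, requested for route PneNP/NegLimited of the cell
pnp-ideate — items stmt-PneNP-0413, stmt-PneNP-19860, stmt-PneNP-19861) from

* B. Cavalar, M. Göös, A. Riazanov, A. Sofronova, D. Sokolov, *Monotone Circuit Complexity of
  Matching*, Proc. 58th STOC (2026) 1128–1132; ECCC TR25 / arXiv:2507.16105 (held as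
  `paper:arxiv-2507.16105`, cited below by the sections of that text) [CavalarEtAl2026]
  ("CGRSS 2025").

**The printed results.**

* Theorem 1 (§1, p. 1): "`PM` requires monotone circuits of size at least `2^{n^{1/3-o(1)}}`."
  Here `PM : {0,1}^{n×n} → {0,1}` is the bipartite perfect matching function of the adjacency
  matrix of a bipartite graph on `n + n` vertices — the logical permanent
  `Literature.Barriers.PneNP.perfectMatchingFn n` of `MonotoneGap.lean`, for which the tree
  PROVES Razborov's `n^{Ω(log n)}` (`Razborov1985b_perfectMatching_holds`); CGRSS answer the
  long-standing question whether Razborov's bound is tight (Jukna, *Boolean Function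
  Complexity*, Research Problem 9.39).
* Definition 1 (§1.1, odd cut distribution `𝒟₀`): "To sample `x ∼ 𝒟₀`, first sample a uniform
  random colouring `c ∈ {0,1}^{2n}` of the vertices of `K_{n,n}` with an odd number of `1`s. To
  build the bipartite graph `x`, connect any two vertices (on opposite sides) that have the same
  colour under `c`. The resulting graph is a union of two odd-sized bicliques" — in particular it
  has no perfect matching, `𝒟₀` is a distribution over `PM⁻¹(0)` (PROVED below).
* `ε`-matching sunflower (§1.1): a family `𝓕` of `ℓ`-matchings in `K_{n,n}`, `|𝓕| ≥ 2`, whose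
  core `K = ⋂ 𝓕` satisfies
  `Pr_{c ∼ 𝒟₀}[∃ M ∈ 𝓕, ∀ e ∈ M ∖ K : e is monochromatic under c] ≥ 1 - ε`.
* Lemma 2 (§1.1, Matching Sunflower Lemma; proof §2): "There exists a universal constant
  `c > 0` such that every family `𝓕` of `ℓ`-matchings of size `|𝓕| ≥ (c ℓ log²(ℓ/ε))^ℓ`
  contains an `ε`-matching sunflower." (By a reduction to the robust sunflower lemma of
  Alweiss–Lovett–Wu–Zhang / Rao via "blocky" families; Razborov's argument implicitly gives
  `4^{ℓ²} (c ℓ log(1/ε))^{2ℓ}`.)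

**What this file adds**, over the vocabulary of `PerfectMatchingColorings.lean` /
`PerfectMatchingApproximators.lean` (`Vtx m = Fin m ⊕ Fin m`, `Edge m = Fin m × Fin m`,
`colorGraph c` = the graph of a colouring, `flipAt`, `IsMatching`) and of `MonotoneGap.lean`
(`perfectMatchingFn`, `circuitSizeOver monotoneBasis`):

* `PerfectMatching.oddColorings m` — the support of `𝒟₀`; PROVED: `two_mul_card_oddColorings`
  (exactly half of the `4^m` colourings are odd, `m ≥ 1`) and
  `perfectMatchingFn_colorInput_of_mem_oddColorings` (odd cut graphs have no perfect matching);
* `PerfectMatching.core 𝓕`, `PerfectMatching.IsMatchingSunflower ε 𝓕` (the counting form of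
  the `𝒟₀`-probability: `(1 - ε) · #oddColorings ≤ #{c odd : ∃ M ∈ 𝓕, M ∖ K ⊆ colorGraph c}`);
  PROVED: `IsMatchingSunflower.mono` (monotone in `ε`), `IsMatchingSunflower.two_le_card`;
* the named facts `CavalarEtAl2026_matchingSunflower` (Lemma 2) and
  `CavalarEtAl2026_perfectMatching` (Theorem 1, read as: for every `δ > 0`, for all large `n`,
  monotone size `≥ 2^{n^{1/3-δ}}` — the meaning of `2^{n^{1/3-o(1)}}`), with the PROVED
  corollary `CavalarEtAl2026_perfectMatching.two_pow_rpow` (`∃ c > 0`, eventually `≥ 2^{n^c}`,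
  the `2^{n^{Ω(1)}}` shape quoted by the NegLimited items).

**Faithfulness.** Monotone circuits are fan-in-2 `{∧, ∨}` circuits (`Circuit.IsOver
monotoneBasis`) and size is the tree's gate count `circuitSizeOver` (attained for `PM`, not the
junk value `0`: `Literature.Barriers.PneNP.exists_monotone_circuit_perfectMatchingFn`); a lower
bound against any wider monotone gate set implies this one, and the `∀ δ > 0`-eventually form
is insensitive to constant factors and additive `poly(n)` terms in the size convention. In
Lemma 2 the logarithm is the natural one and `ε ∈ (0, 1/2]` is explicit (the proof, §2, takes
"`ε < 1/2` wlog"; for `ℓ = 1` and `ε → 1` the printed threshold degenerates) — both at most as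
strong as print, the base of the logarithm being absorbed by the existential constant `c`
inside the `ℓ`-th power. NOT vendored: Theorem 2 (a monotone function in `L`, odd factor, of
monotone complexity `2^{n^{Ω(1)}}`), Theorem 3 (monotone `f_k ∈ AC⁰` of monotone complexity
`n^{Ω(log^k n)}`, answering Grigni–Sipser) and the general trade-off `inf_{w} Ω(n/r_w)^w` of §4
— they need the odd-factor / `AC⁰` vocabularies resp. the parametrised sunflower bound
`r(ℓ, ε)`; and no proof of Lemma 2 / Theorem 1 (the tree has the spread lemma
`Literature.Combinatorics.SetFamily.spread_lemma` and Razborov's lattice, but not yet Rao's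
robust sunflower lemma in set form nor the blocky reduction of §2).
-/

namespace Literature.Computability.Complexity

namespace PerfectMatching

open Finset Literature.Barriers.PneNP

variable {m : ℕ}

/-! ### The odd cut distribution -/

/-- The support of the **odd cut distribution** `𝒟₀`: the two-colourings of the `m + m` vertices
of `K_{m,m}` with an odd number of `1`s (`𝒟₀` is uniform on them; the sampled graph is
`colorGraph c`, the union of the two monochromatic bicliques). [cite: CavalarEtAl2026, Def. 1 (§1.1)] -/
def oddColorings (m : ℕ) : Finset (Vtx m → Bool) :=
  univ.filter fun c => Odd #(univ.filter fun v => c v = true)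

/-- Membership in `oddColorings`. [cite: CavalarEtAl2026, Def. 1 (§1.1)] -/
@[simp] theorem mem_oddColorings {c : Vtx m → Bool} :
    c ∈ oddColorings m ↔ Odd #(univ.filter fun v => c v = true) := by
  simp [oddColorings]

/-- Recolouring one vertex adds or removes exactly that vertex from the `1`-coloured set.
[folklore] -/
private theorem filter_flipAt_eq (c : Vtx m → Bool) (w : Vtx m) :
    (univ.filter fun v => flipAt c w v = true) =
      if c w = true then (univ.filter fun v => c v = true).erase w
      else insert w (univ.filter fun v => c v = true) := by
  ext v
  by_cases hv : v = w
  · subst hv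
    cases h : c v <;> simp [h]
  · split_ifs with h <;> simp [flipAt_apply_of_ne c hv, hv]

/-- Recolouring one vertex changes the parity of the number of `1`s. [folklore] -/
private theorem odd_card_filter_flipAt_iff (c : Vtx m → Bool) (w : Vtx m) :
    Odd #(univ.filter fun v => flipAt c w v = true) ↔ ¬ Odd #(univ.filter fun v => c v = true) := by
  rw [filter_flipAt_eq]
  split_ifs with h
  · have hw : w ∈ univ.filter fun v => c v = true := by simp [h]
    rw [card_erase_of_mem hw]
    have h1 : 1 ≤ #(univ.filter fun v => c v = true) := card_pos.2 ⟨w, hw⟩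
    simp only [Nat.odd_iff]
    omega
  · have hw : w ∉ univ.filter fun v => c v = true := by simp [h]
    rw [card_insert_of_notMem hw]
    simp only [Nat.odd_iff]
    omega

/-- **Exactly half of the colourings are odd**: `2 · #oddColorings m = 4^m` for `m ≥ 1` (the
involution recolouring a fixed vertex exchanges odd and even colourings). So `𝒟₀` is a
distribution on a nonempty set. [cite: CavalarEtAl2026, Def. 1 (§1.1)] -/
theorem two_mul_card_oddColorings (hm : 1 ≤ m) : 2 * #(oddColorings m) = 4 ^ m := by
  have w : Vtx m := Sum.inl ⟨0, hm⟩
  rw [oddColorings, card_filter_flip univ w (fun _ _ => mem_univ _) _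
    (fun c => odd_card_filter_flipAt_iff c w), card_univ, card_colorings]

/-- The number of `1`-coloured vertices splits into the two sides. [folklore] -/
private theorem card_filter_vtx_eq_add (c : Vtx m → Bool) :
    #(univ.filter fun v : Vtx m => c v = true) =
      #(univ.filter fun u : Fin m => c (Sum.inl u) = true) +
        #(univ.filter fun v : Fin m => c (Sum.inr v) = true) := by
  simp only [card_filter, Fintype.sum_sum_type]

/-- **`𝒟₀` is supported on `PM⁻¹(0)`**: the graph of an odd colouring (a union of two bicliques
`L₀ × R₀ ∪ L₁ × R₁` with `|L₁| + |R₁|` odd, hence `|L₁| ≠ |R₁|`) has no perfect matching.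
[cite: CavalarEtAl2026, Def. 1 (§1.1: "odd cut distribution 𝒟₀ over PM⁻¹(0)")] -/
theorem perfectMatchingFn_colorInput_of_mem_oddColorings {c : Vtx m → Bool}
    (hc : c ∈ oddColorings m) : perfectMatchingFn m (colorInput c) = false := by
  cases h : perfectMatchingFn m (colorInput c)
  · rfl
  · exfalso
    have hodd := mem_oddColorings.1 hc
    rw [card_filter_vtx_eq_add, card_filter_eq_of_perfectMatchingFn_colorInput h] at hodd
    simp only [Nat.odd_iff] at hodd
    omega

/-! ### Matching sunflowers -/

/-- The **core** `K = ⋂ 𝓕` of a family of edge sets (all of `K_{m,m}` for the empty family).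
[cite: CavalarEtAl2026, §1.1] -/
def core (𝓕 : Finset (Finset (Edge m))) : Finset (Edge m) :=
  univ.filter fun e => ∀ M ∈ 𝓕, e ∈ M

/-- Membership in the core. [cite: CavalarEtAl2026, §1.1] -/
@[simp] theorem mem_core {𝓕 : Finset (Finset (Edge m))} {e : Edge m} :
    e ∈ core 𝓕 ↔ ∀ M ∈ 𝓕, e ∈ M := by
  simp [core]

/-- The core is contained in every member (`K = ⋂ 𝓕`). [cite: CavalarEtAl2026, §1.1] -/
theorem core_subset {𝓕 : Finset (Finset (Edge m))} {M : Finset (Edge m)} (hM : M ∈ 𝓕) :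
    core 𝓕 ⊆ M := fun _ he => mem_core.1 he M hM

/-- An **`ε`-matching sunflower**: a family `𝓕` of (matchings, in the source `ℓ`-matchings)
with `|𝓕| ≥ 2` whose core `K` satisfies
`Pr_{c ∼ 𝒟₀}[∃ M ∈ 𝓕, ∀ e ∈ M ∖ K, e monochromatic under c] ≥ 1 - ε`, written as a count over
the support `oddColorings m` of the uniform distribution `𝒟₀` ("whenever `t_K` accepts, it is
highly likely that `⋁_{M ∈ 𝓕} t_M` accepts too"). [cite: CavalarEtAl2026, §1.1 (display before Lemma 2)] -/
def IsMatchingSunflower (ε : ℝ) (𝓕 : Finset (Finset (Edge m))) : Prop :=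
  2 ≤ #𝓕 ∧
    (1 - ε) * (#(oddColorings m) : ℝ) ≤
      #((oddColorings m).filter fun c => ∃ M ∈ 𝓕, M \ core 𝓕 ⊆ colorGraph c)

/-- A matching sunflower has at least two members. [cite: CavalarEtAl2026, §1.1] -/
theorem IsMatchingSunflower.two_le_card {ε : ℝ} {𝓕 : Finset (Finset (Edge m))}
    (h : IsMatchingSunflower ε 𝓕) : 2 ≤ #𝓕 := h.1

/-- The sunflower condition is monotone in the error parameter `ε` (immediate from the
definition). [cite: CavalarEtAl2026, §1.1 (display before Lemma 2)] -/
theorem IsMatchingSunflower.mono {ε ε' : ℝ} {𝓕 : Finset (Finset (Edge m))}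
    (h : IsMatchingSunflower ε 𝓕) (hε : ε ≤ ε') : IsMatchingSunflower ε' 𝓕 := by
  refine ⟨h.1, le_trans ?_ h.2⟩
  exact mul_le_mul_of_nonneg_right (by linarith) (Nat.cast_nonneg _)

end PerfectMatching

open Finset Filter PerfectMatching Literature.Barriers.PneNP

/-! ### The named facts -/

/-- **CGRSS Matching Sunflower Lemma** (verbatim): "There exists a universal constant `c > 0`
such that every family `𝓕` of `ℓ`-matchings of size `|𝓕| ≥ (c ℓ log²(ℓ/ε))^ℓ` contains an
`ε`-matching sunflower." Here: `𝓕` a family of matchings of `K_{m,m}` with `ℓ ≥ 1` edges each,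
`0 < ε ≤ 1/2`, natural logarithm; conclusion: some sub-family `𝓕' ⊆ 𝓕` is an `ε`-matching
sunflower (`IsMatchingSunflower`, w.r.t. the odd cut distribution). (Proof, loc. cit. §2: a
random labelling `b ∈ [ℓ]^{2m}` is consistent with an `ℓ`-matching with probability
`ℓ!/ℓ^{2ℓ} ≥ ℓ^{-ℓ} 2^{-O(ℓ)}`; for the resulting blocky family the endpoint sets determine the
matchings, the robust sunflower lemma gives an `ε/2`-robust "vertex" sunflower, and Claim 1
converts it into an `ε`-matching sunflower with core the block-internal pairs of the vertex
core, conditioning on the colours of the singly-covered core vertices and finally on odd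
parity, which at most doubles the error.)
[cite: CavalarEtAl2026, Lemma 2 (§1.1; proof §2, Claim 1)] -/
def CavalarEtAl2026_matchingSunflower : Prop :=
  ∃ c : ℝ, 0 < c ∧ ∀ (m ℓ : ℕ) (ε : ℝ), 1 ≤ ℓ → 0 < ε → ε ≤ 1 / 2 →
    ∀ 𝓕 : Finset (Finset (Edge m)), (∀ M ∈ 𝓕, IsMatching M ∧ #M = ℓ) →
      (c * ℓ * Real.log (ℓ / ε) ^ 2) ^ ℓ ≤ (#𝓕 : ℝ) →
        ∃ 𝓕' ⊆ 𝓕, IsMatchingSunflower ε 𝓕'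

/-- **CGRSS Theorem 1** (verbatim): "`PM` requires monotone circuits of size at least
`2^{n^{1/3-o(1)}}`." Here: for every `δ > 0`, for all sufficiently large `n`, every circuit over
`{∧₂, ∨₂}` computing the perfect matching function of `K_{n,n}` (`perfectMatchingFn n`, `n²`
variables) has at least `2^{n^{1/3-δ}}` gates:
`2^{n^{1/3-δ}} ≤ circuitSizeOver monotoneBasis (perfectMatchingFn n)`. (Proof, loc. cit. §3–4:
the approximation method with plucking by the Matching Sunflower Lemma relative to `𝒟₀`.)
Improves `Razborov1985b_perfectMatching` (`n^{Ω(log n)}`, proved in the tree).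
[cite: CavalarEtAl2026, Thm. 1 (§1; proof §3–§4)] -/
def CavalarEtAl2026_perfectMatching : Prop :=
  ∀ δ : ℝ, 0 < δ → ∀ᶠ n : ℕ in atTop,
    (2 : ℝ) ^ ((n : ℝ) ^ (1 / 3 - δ)) ≤ circuitSizeOver monotoneBasis (perfectMatchingFn n)

/-- Corollary (the `2^{n^{Ω(1)}}` shape): given Theorem 1, there is `c > 0` (e.g. `c = 1/6`)
with `2^{n^c} ≤ circuitSizeOver monotoneBasis (perfectMatchingFn n)` for all large `n`.
[cite: CavalarEtAl2026, Thm. 1] -/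
theorem CavalarEtAl2026_perfectMatching.two_pow_rpow (h : CavalarEtAl2026_perfectMatching) :
    ∃ c : ℝ, 0 < c ∧ ∀ᶠ n : ℕ in atTop,
      (2 : ℝ) ^ ((n : ℝ) ^ c) ≤ circuitSizeOver monotoneBasis (perfectMatchingFn n) := by
  refine ⟨1 / 6, by norm_num, (h (1 / 6) (by norm_num)).mono fun n hn => ?_⟩
  rwa [show (1 : ℝ) / 3 - 1 / 6 = 1 / 6 by norm_num] at hn

/-- Corollary (explicit exponent): given Theorem 1, `2^{n^{1/4}} ≤` the monotone complexity of
`PM` for all large `n`. [cite: CavalarEtAl2026, Thm. 1] -/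
theorem CavalarEtAl2026_perfectMatching.one_fourth (h : CavalarEtAl2026_perfectMatching) :
    ∀ᶠ n : ℕ in atTop,
      (2 : ℝ) ^ ((n : ℝ) ^ ((1 : ℝ) / 4)) ≤ circuitSizeOver monotoneBasis (perfectMatchingFn n) := by
  refine (h (1 / 12) (by norm_num)).mono fun n hn => ?_
  rwa [show (1 : ℝ) / 3 - 1 / 12 = 1 / 4 by norm_num] at hn

end Literature.Computability.Complexity
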